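import Literature.AlgebraicGeometry.Resolution.AlterationsPreSemiStableToSemiStableProofs
import Literature.AlgebraicGeometry.Resolution.SemiStableFibresIntegral
import Literature.AlgebraicGeometry.Resolution.AlterationsProofs
import Summits.ResolutionOfSingularities.ResolutionOfSingularities.Theorems.WildQuotientsSummitReductionStubPairRegularBaseChangeLemmas
import HarnessLib

/-!
# `WildQuotients.SummitReduction` (stmt-ResolutionOfSingularities-16324), line `FramePerfect`:
# base-change lemmas for stub `stub_pair_regularBaseChange` (de Jong 1997, 5.4 / 1996, 4.22: pulling a semi-stable datum back along an alteration of the base, over an arbitrary field)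

Route `ResolutionOfSingularities/WildQuotients`, crux `SummitReduction`; second helper file of stub
`stub_pair_regularBaseChange` of the line skeleton `Cruxes/SummitReduction/Lines/FramePerfect.lean`
(v6). The tree's `DeJong1996.PreSemiStablePair.*` lemmas (`AlterationsPreSemiStablePullback.lean`,
`SemiStableFibresIntegral.lean`) do the non-equivariant base change `𝒳 = 𝒞 ×_Y Y' → Y'` of a
semi-stable curve with sections, but packaged in the structure `PreSemiStablePair`, which records
that the base `Y` is projective over `k` — not available for the `G₁`-semi-stable model `X₁ → Y₁`
of the stub (only `X₁` is known projective). This file re-proves the needed pieces from the bare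
hypotheses, all hypothesis-free:

* `semiStableCurve_surjective` — a semi-stable curve is surjective (its geometric fibres are
  connected, in particular non-empty; de Jong 1996, 2.21);
* `genericPoint_notMem_of_preimage_subset_sncd` — if `ψ⁻¹(D)` lies in a strict normal crossings
  divisor for a dominant `ψ`, the generic point is off `D`;
* `isIntegral_pullback_of_isSemiStableCurve` — `X ×_Y Y'` is integral for `Y'` integral, `ψ`
  dominant and `f` a semi-stable curve smooth over `Y ∖ D ∌ η_Y` (the generic fibre is smooth and
  connected over the field `κ(η_{Y'})`, hence integral; Liu 2002, Prop. 4.3.8,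
  `Liu2002IntegralOfFlat_holds`);
* `isAlteration_pullback_fst_of_isSemiStableCurve` — `X ×_Y Y' → X` is an alteration if `ψ` is
  (de Jong 1996, 2.20/4.22);
* `isSeparated_base_of_isSemiStableCurve`, `isProjectiveOver_pullback_of_isSemiStableCurve` — the
  base of a proper surjective curve with separated total space is separated, so `X ×_Y Y'` is
  projective over `k` when `X` and `Y'` are (closed in `X ×_k Y'`, Segre);
* `smooth_pullback_snd_morphismRestrict` — `X ×_Y Y' → Y'` is smooth outside any closed
  `D' ⊇ ψ⁻¹(D)`;
* `exists_smooth_pullbackSection`, `pairwise_disjoint_pullbackSection`,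
  `preimage_fst_semiStableBoundary_subset` — the pulled-back sections are disjoint sections into
  the smooth locus, and the boundary pulls back into the boundary of `(X ×_Y Y', D', τ')`.
-/

set_option linter.dupNamespace false

noncomputable section

open CategoryTheory CategoryTheory.Limits AlgebraicGeometry TopologicalSpace
open Literature.AlgebraicGeometry.Resolution
open Literature.AlgebraicGeometry

namespace Summit.ResolutionOfSingularities.ResolutionOfSingularities.Theorems

universe u

variable {X Y Y' : Scheme.{u}} {f : X ⟶ Y}

/-! ## Surjectivity, the generic point, fibres over fields -/

/-- **A semi-stable curve is surjective**: the geometric fibre over (an algebraic closure of the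
residue field of) any point is connected, hence non-empty (de Jong 1996, 2.21).
[cite: DeJong1996, 2.21, p. 61] -/
theorem semiStableCurve_surjective (h : IsSemiStableCurve f) : Surjective f := by
  refine ⟨fun y => ?_⟩
  let K : Type u := AlgebraicClosure (Y.residueField y)
  let s : Spec (.of K) ⟶ Y :=
    Spec.map (CommRingCat.ofHom (algebraMap (Y.residueField y) K)) ≫ Y.fromSpecResidueField y
  haveI := h.connectedSpace_pullback K s
  obtain ⟨z⟩ := (inferInstance : Nonempty ↥(pullback f s))
  refine ⟨pullback.fst f s z, ?_⟩
  rw [← Scheme.Hom.comp_apply, pullback.condition, Scheme.Hom.comp_apply]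
  exact Scheme.fromSpecResidueField_apply y _

/-- **The generic point is off `D` as soon as `ψ⁻¹(D)` lies in a strict normal crossings divisor
of the source of a dominant `ψ`** (a dominant map sends the generic point to the generic point,
which is off every strict normal crossings divisor). [folklore] -/
theorem genericPoint_notMem_of_preimage_subset_sncd [IsIntegral Y] [IsIntegral Y'] (ψ : Y' ⟶ Y)
    [IsDominant ψ] {D : Set Y} {D' : Set Y'} (hD' : IsStrictNormalCrossingsDivisor Y' D')
    (h : ψ.base ⁻¹' D ⊆ D') : genericPoint Y ∉ D := by
  intro hη
  rw [← genericPoint_eq_of_isDominant ψ] at hη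
  exact hD'.genericPoint_notMem (h hη)

/-- **The family is smooth over base changes landing off `D`**: if `f` is smooth over `Y ∖ D` and
`s : T → Y` misses `D` then `X ×_Y T → T` is smooth (every point of `X ×_Y T` lies over
`f⁻¹(Y ∖ D)`; base change). [cite: DeJong1996, 4.22, p. 75] -/
theorem smooth_pullback_snd_of_forall_notMem {D : Set Y} (hD : IsClosed D)
    (hsm : Smooth (f ∣_ ⟨Dᶜ, hD.isOpen_compl⟩)) {T : Scheme.{u}} (s : T ⟶ Y)
    (hs : ∀ t, s t ∉ D) : Smooth (pullback.snd f s) := by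
  let U : Y.Opens := ⟨Dᶜ, hD.isOpen_compl⟩
  have hfU : Smooth ((f ⁻¹ᵁ U).ι ≫ f) := by
    rw [← morphismRestrict_ι]
    haveI := hsm
    infer_instance
  have h1 := ι_comp_pullback_snd_of_ι_comp (P := @Smooth) f s (f ⁻¹ᵁ U) hfU
  have htop : pullback.fst f s ⁻¹ᵁ (f ⁻¹ᵁ U) = ⊤ := by
    ext x
    simp only [Opens.coe_top, Set.mem_univ, iff_true]
    show f (pullback.fst f s x) ∈ (U : Set Y)
    rw [← Scheme.Hom.comp_apply, pullback.condition, Scheme.Hom.comp_apply]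
    exact hs _
  rw [htop, ← Scheme.topIso_hom] at h1
  exact (MorphismProperty.cancel_left_of_respectsIso @Smooth _ _).mp h1

/-- **The fibres of a semi-stable curve over field-valued points are connected**: the base change
to an algebraic closure is a geometric fibre (2.21: connected) and maps onto the fibre.
[cite: DeJong1996, 2.21, p. 61] -/
theorem connectedSpace_pullback_of_isSemiStableCurve (h : IsSemiStableCurve f) (K : Type u)
    [Field K] (s : Spec (.of K) ⟶ Y) : ConnectedSpace ↥(pullback f s) := by
  let Kbar : Type u := AlgebraicClosure K
  let ι : Spec (.of Kbar) ⟶ Spec (.of K) := Spec.map (CommRingCat.ofHom (algebraMap K Kbar))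
  haveI : ConnectedSpace ↥(pullback f (ι ≫ s)) := h.connectedSpace_pullback Kbar _
  let e := pullbackLeftPullbackSndIso f s ι
  haveI : ConnectedSpace ↥(pullback (pullback.snd f s) ι) :=
    (Scheme.homeoOfIso e.symm).surjective.connectedSpace (Scheme.homeoOfIso e.symm).continuous
  haveI : Subsingleton ↥(Spec (CommRingCat.of K)) :=
    inferInstanceAs (Subsingleton (PrimeSpectrum K))
  haveI : Surjective ι :=
    ⟨fun x => ⟨(⟨⊥, Ideal.isPrime_bot⟩ : PrimeSpectrum Kbar), Subsingleton.elim _ _⟩⟩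
  exact (pullback.fst (pullback.snd f s) ι).surjective.connectedSpace
    (pullback.fst (pullback.snd f s) ι).continuous

/-- **The fibres over field-valued points off `D` are integral**: smooth (`f` is smooth over
`Y ∖ D`) — hence with integral local rings and reduced — and connected, hence irreducible.
[cite: DeJong1996, 4.22, p. 75] -/
theorem isIntegral_pullback_field_of_isSemiStableCurve (h : IsSemiStableCurve f) {D : Set Y}
    (hD : IsClosed D) (hsm : Smooth (f ∣_ ⟨Dᶜ, hD.isOpen_compl⟩)) (K : Type u) [Field K]
    (s : Spec (.of K) ⟶ Y) (hs : ∀ t, s t ∉ D) : IsIntegral (pullback f s) := by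
  haveI := smooth_pullback_snd_of_forall_notMem hD hsm s hs
  haveI := connectedSpace_pullback_of_isSemiStableCurve h K s
  haveI : IsLocallyNoetherian (pullback f s) :=
    LocallyOfFiniteType.isLocallyNoetherian (pullback.snd f s)
  haveI : IrreducibleSpace ↥(pullback f s) :=
    Literature.AlgebraicGeometry.Motives.irreducibleSpace_of_isDomain_stalk _
      (isDomain_stalk_of_smooth (pullback.snd f s))
  haveI : IsReduced (pullback f s) := isReduced_of_smooth (pullback.snd f s)
  exact isIntegral_of_irreducibleSpace_of_isReduced _

/-- **`X ×_Y Y'` is integral** (de Jong 1996, 4.22 "Pulling back the family"; Liu 2002,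
Prop. 4.3.8): for a semi-stable curve `f : X → Y` smooth over `Y ∖ D` with `η_Y ∉ D`, an integral
`Y'` and a dominant `ψ : Y' → Y`, the flat `X ×_Y Y' → Y'` has integral generic fibre
`X ×_Y Spec κ(η_{Y'})` (`ψ(η_{Y'}) = η_Y ∉ D`), so the total space is integral
(`Liu2002IntegralOfFlat_holds`). No algebraic closedness of the ground field and no generic
étaleness of `ψ` are needed. [cite: Liu2002, Prop. 4.3.8] -/
theorem isIntegral_pullback_of_isSemiStableCurve {X Y Y' : Scheme.{u}} {f : X ⟶ Y} [IsIntegral Y]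
    [IsIntegral Y'] (h : IsSemiStableCurve f) {D : Set Y} (hD : IsClosed D)
    (hsm : Smooth (f ∣_ ⟨Dᶜ, hD.isOpen_compl⟩)) (hη : genericPoint Y ∉ D) (ψ : Y' ⟶ Y)
    [IsDominant ψ] : IsIntegral (pullback f ψ) := by
  haveI := h.flat
  have hη' : ψ (genericPoint Y') ∉ D := by
    rwa [genericPoint_eq_of_isDominant ψ]
  haveI : IsIntegral (pullback f (Y'.fromSpecResidueField (genericPoint Y') ≫ ψ)) :=
    isIntegral_pullback_field_of_isSemiStableCurve h hD hsm (Y'.residueField (genericPoint Y'))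
      (Y'.fromSpecResidueField (genericPoint Y') ≫ ψ) fun t => by
      have ht : Y'.fromSpecResidueField (genericPoint Y') t = genericPoint Y' :=
        Scheme.fromSpecResidueField_apply _ t
      rw [Scheme.Hom.comp_apply, ht]
      exact hη'
  haveI : IsIntegral ((pullback.snd f ψ).fiber (genericPoint Y')) :=
    IsIntegral.of_isIso
      (pullbackLeftPullbackSndIso f ψ (Y'.fromSpecResidueField (genericPoint Y'))).inv
  exact Liu2002IntegralOfFlat_holds _ Y' (pullback.snd f ψ) ‹_›

/-! ## The projection `X ×_Y Y' → X` is an alteration; separatedness and projectivity -/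

/-- **`X ×_Y Y' → X` is an alteration if `ψ : Y' → Y` is** (de Jong 1996, 2.20 with 4.22): proper
and surjective as a base change of `ψ`, finite over `f⁻¹(V)` if `ψ` is finite over `V` — non-empty
as `f` is surjective — and `X ×_Y Y'` is integral by hypothesis. [cite: DeJong1996, 4.22, p. 75] -/
theorem isAlteration_pullback_fst_of_isSemiStableCurve [IsIntegral X] (h : IsSemiStableCurve f)
    {ψ : Y' ⟶ Y} (hψ : IsAlteration ψ) [IsIntegral (pullback f ψ)] :
    IsAlteration (pullback.fst f ψ) := by
  haveI := hψ.isProper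
  haveI : Surjective ψ := hψ.surjective
  haveI : Surjective f := semiStableCurve_surjective h
  refine ⟨‹_›, inferInstance, inferInstance, ?_⟩
  obtain ⟨V, ⟨y, hy⟩, hfin⟩ := hψ.exists_isFinite
  haveI := hfin
  obtain ⟨x, hx⟩ := f.surjective y
  exact ⟨f ⁻¹ᵁ V, ⟨x, show f x ∈ V by rw [hx]; exact hy⟩,
    morphismRestrict_pullback_fst_of_morphismRestrict (P := @IsFinite) f ψ V inferInstance⟩

/-- **The base of a semi-stable curve with separated total space is separated**: `f` is proper
and surjective, so separatedness descends (`isSeparated_of_surjective_of_universallyClosed`).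
[folklore] -/
theorem isSeparated_base_of_isSemiStableCurve (h : IsSemiStableCurve f) [X.IsSeparated] :
    Y.IsSeparated := by
  haveI := h.isProper
  haveI := semiStableCurve_surjective h
  exact isSeparated_of_surjective_of_universallyClosed f

/-- **`X ×_Y Y'` is projective over `k` when `X` and `Y'` are** (de Jong 1996, 4.22): `X` projective
over `k` through the proper surjective `f` makes `Y → Spec k` separated, so `X ×_Y Y'` is a closed
subscheme of `X ×_k Y'`, which is projective by the Segre embedding (`isProjectiveOver_pullback`).
[cite: DeJong1996, 4.22, p. 75] -/
theorem isProjectiveOver_pullback_of_isSemiStableCurve {k : Type u} [Field k]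
    (h : IsSemiStableCurve f) (q : Y ⟶ Spec (.of k))
    (hX : Motives.IsProjectiveOver (Over.mk (f ≫ q))) (ψ : Y' ⟶ Y)
    (hY' : Motives.IsProjectiveOver (Over.mk (ψ ≫ q))) :
    Motives.IsProjectiveOver (Over.mk (pullback.snd f ψ ≫ ψ ≫ q)) := by
  haveI : IsProper (f ≫ q) := Motives.IsProjectiveOver.isProper (X := Over.mk (f ≫ q)) hX
  haveI : IsSeparated (f ≫ q) := inferInstance
  haveI : X.IsSeparated := (HasAffineProperty.iff_of_isAffine (P := @IsSeparated)).mp ‹_›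
  haveI : Y.IsSeparated := isSeparated_base_of_isSemiStableCurve h
  exact isProjectiveOver_pullback f q ψ (ψ ≫ q) rfl hX hY'

/-! ## Smoothness outside `D'`, the pulled-back sections, the boundary -/

/-- **`X ×_Y Y' → Y'` is smooth outside any closed `D' ⊇ ψ⁻¹(D)`** if `f` is smooth outside `D`:
over `Y' ∖ D' ⊆ ψ⁻¹(Y ∖ D)` it is a restriction of a base change of `f` over `Y ∖ D`.
[cite: DeJong1996, 4.22, p. 75] -/
theorem smooth_pullback_snd_morphismRestrict {D : Set Y} (hD : IsClosed D)
    (hsm : Smooth (f ∣_ ⟨Dᶜ, hD.isOpen_compl⟩)) (ψ : Y' ⟶ Y) {D' : Set Y'} (hD' : IsClosed D')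
    (hDD' : ψ.base ⁻¹' D ⊆ D') :
    Smooth (pullback.snd f ψ ∣_ ⟨D'ᶜ, hD'.isOpen_compl⟩) := by
  let U : Y.Opens := ⟨Dᶜ, hD.isOpen_compl⟩
  let V : Y'.Opens := ⟨D'ᶜ, hD'.isOpen_compl⟩
  have hVU : V ≤ ψ ⁻¹ᵁ U := fun y hy hyD => hy (hDD' hyD)
  -- `snd` is smooth over `ψ⁻¹ U`
  have hfU : Smooth ((f ⁻¹ᵁ U).ι ≫ f) := by
    rw [← morphismRestrict_ι]
    haveI := hsm
    infer_instance
  have h1 := ι_comp_pullback_snd_of_ι_comp (P := @Smooth) f ψ (f ⁻¹ᵁ U) hfU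
  have he : pullback.fst f ψ ⁻¹ᵁ (f ⁻¹ᵁ U) = pullback.snd f ψ ⁻¹ᵁ (ψ ⁻¹ᵁ U) := by
    rw [← Scheme.Hom.comp_preimage, ← Scheme.Hom.comp_preimage, pullback.condition]
  rw [he, ← morphismRestrict_ι] at h1
  have h2 : Smooth (pullback.snd f ψ ∣_ ψ ⁻¹ᵁ U) :=
    MorphismProperty.of_postcomp (W := @Smooth) (W' := @IsOpenImmersion) _ (ψ ⁻¹ᵁ U).ι
      inferInstance h1
  -- restrict further to `V ≤ ψ⁻¹ U`
  have h3 : Smooth ((pullback.snd f ψ ∣_ ψ ⁻¹ᵁ U) ∣_ (ψ ⁻¹ᵁ U).ι ⁻¹ᵁ V) := inferInstance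
  have hV : (ψ ⁻¹ᵁ U).ι ''ᵁ ((ψ ⁻¹ᵁ U).ι ⁻¹ᵁ V) = V := by
    rw [Scheme.Hom.image_preimage_eq_opensRange_inf, Scheme.Opens.opensRange_ι]
    exact inf_eq_right.mpr hVU
  rwa [MorphismProperty.arrow_mk_iso_iff (P := @Smooth) (morphismRestrictRestrict _ _ _),
    MorphismProperty.arrow_mk_iso_iff (P := @Smooth) (morphismRestrictEq _ hV)] at h3

variable {n : ℕ} {σ : Fin n → (Y ⟶ X)}

/-- **The pulled-back sections map into the smooth locus** of `X ×_Y Y' → Y'` if the `σᵢ` map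
into that of `f` (base change of a smooth neighbourhood). [cite: DeJong1996, 4.22, p. 75] -/
theorem exists_smooth_pullbackSection (hσ : ∀ i, σ i ≫ f = 𝟙 Y)
    (hsm : ∀ i, ∃ U : X.Opens, Set.range (σ i) ⊆ (U : Set X) ∧ Smooth (U.ι ≫ f)) (ψ : Y' ⟶ Y)
    (i : Fin n) : ∃ U : (pullback f ψ).Opens,
      Set.range (DeJong1996.PreSemiStablePair.pullbackSection hσ ψ i) ⊆ (U : Set ↥(pullback f ψ)) ∧
        Smooth (U.ι ≫ pullback.snd f ψ) := by
  obtain ⟨U, hU, hsmU⟩ := hsm i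
  refine ⟨pullback.fst f ψ ⁻¹ᵁ U, ?_, ι_comp_pullback_snd_of_ι_comp (P := @Smooth) f ψ U hsmU⟩
  rintro _ ⟨y, rfl⟩
  show pullback.fst f ψ (DeJong1996.PreSemiStablePair.pullbackSection hσ ψ i y) ∈ U
  rw [← Scheme.Hom.comp_apply, DeJong1996.PreSemiStablePair.pullbackSection_fst]
  exact hU ⟨ψ y, rfl⟩

/-- **The pulled-back sections are pairwise disjoint** if the `σᵢ` are (their images map to the
images of the `σᵢ` under the projection to `X`). [cite: DeJong1996, 4.22, p. 75] -/
theorem pairwise_disjoint_pullbackSection (hσ : ∀ i, σ i ≫ f = 𝟙 Y)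
    (hdisj : Pairwise fun i j => Disjoint (Set.range (σ i)) (Set.range (σ j))) (ψ : Y' ⟶ Y) :
    Pairwise fun i j => Disjoint (Set.range (DeJong1996.PreSemiStablePair.pullbackSection hσ ψ i))
      (Set.range (DeJong1996.PreSemiStablePair.pullbackSection hσ ψ j)) := by
  intro i j hij
  rw [DeJong1996.PreSemiStablePair.range_pullbackSection,
    DeJong1996.PreSemiStablePair.range_pullbackSection]
  exact (hdisj hij).preimage _

/-- **The boundary pulls back into the boundary**: `pr⁻¹(⋃ᵢ σᵢ(Y) ∪ f⁻¹(D)) ⊆ ⋃ᵢ τᵢ(Y') ∪ f'⁻¹(D')`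
for the pulled-back family `f' : X ×_Y Y' → Y'`, its sections `τᵢ` and any `D' ⊇ ψ⁻¹(D)`.
[cite: DeJong1996, 4.22, p. 75] -/
theorem preimage_fst_semiStableBoundary_subset (hσ : ∀ i, σ i ≫ f = 𝟙 Y) (ψ : Y' ⟶ Y)
    {D : Set Y} {D' : Set Y'} (hDD' : ψ.base ⁻¹' D ⊆ D') :
    (pullback.fst f ψ).base ⁻¹' DeJong1996.semiStableBoundary f D σ ⊆
      DeJong1996.semiStableBoundary (pullback.snd f ψ) D'
        (DeJong1996.PreSemiStablePair.pullbackSection hσ ψ) := by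
  intro x hx
  have hx' : x ∈ pullback.fst f ψ ⁻¹' DeJong1996.semiStableBoundary f D σ := hx
  rw [DeJong1996.PreSemiStablePair.preimage_fst_semiStableBoundary hσ ψ] at hx'
  rw [DeJong1996.mem_semiStableBoundary_iff] at hx' ⊢
  exact hx'.imp_right fun h => hDD' h

end Summit.ResolutionOfSingularities.ResolutionOfSingularities.Theorems

end
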